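import Literature.MathematicalPhysics.QuantumFieldTheory.Balaban1983to89.Node00.Sect2FormOfRecord

/-!
# NODE 00 · ROW P11 — `BgProvisoRangedOfRecord`: THE BACKGROUND PROVISO OF [III] p. 259 ON PRINT'S RANGES (def-R, owner of 11b∕11c)

[Balaban1988Convergent] = [III], §2 pp. 257–262.  Sequel (a NEW LEAF; nothing edited in place) of def-R's 11c `Node00.Sect2FormOfRecord` (`BgProviso`, `bgProviso_one`,
`HasSect2Form.norm_E_bg_le`) and 11b `Node00.Sect2FrameOfRecord` (`Sect2.spaceI`, `Sect2.spaceMS`, the ranges `Sect2.admE` ∕ `Sect2.admR` ∕ `Sect2.admB`,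
`Sect2.domSites`); imports 11c only (dag-lead WORDS-123 (b)).

WHY THIS FILE (pub-ymgap INBOX l.15466 dag-n21-c, l.≈15479 node00-def-P11, dag-lead WORDS-122 l.15491, def-R ANSWER-P11-RANGE l.15537).  11c's `BgProviso … k Supp U`
asks, for every retained `𝐖 ∈ Supp s`, every scale `1 ≤ j ≤ k` and EVERY localization domain `X ∈ 𝐃_j` ANYWHERE on the torus, that the background of record
`U_k(s)(𝐖)` read in `Φ` lie in `U^c_j(X, α_{0,j}, α_{1,j})` (`Sect2.spaceI`) and in `Ũ^c_j(X)` (`Sect2.spaceMS`).  Print asserts the first membership only on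
the (2.26)–(2.27) range «X ∈ 𝐃_j, z ∈ X ⊂ Λ_j» (p. 259; the 𝐑-terms of (2.30) live on `X ⊂ Λ_j^{∼−1} ⊂ Λ_j`) and the second only on the (2.41)(i) range
«X ∩ Ω_j ≠ ∅ and X ∩ Z̃_j ≠ ∅» (p. 261) — exactly 11b's `Sect2.admE` (third clause `Y ⊆ Λ j`), `Sect2.admR`, `Sect2.admB`, the ranges on which the §2 form
`sect2ActionDataOfRecord` SUMS the terms.  Off those ranges the unrestricted quantifier is over-strength OF THE FORM, not of print: at positive length the
(2.12) constraints pin the minimiser to `𝐖₀` on every bond sourced in `Ω₁(s)ᶜ` (def-R `eq_W0_of_isMinimizer_genSet`), where retained data are only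
`cR·ε₀`-regular, while condition (i)∕(iii) of [I] (1.11) at scale `j` inside such an `X` wants `|∂𝐔 − 1| < α₀(g_j)·η_j²` (n21-c's ∕ def-P11's located
witness: the all-empty sequence, a one-link field).  THIS FILE types the proviso ON PRINT'S RANGES, `BgProvisoΛ`, as the token a successor record keys its
row P11 to, with: the one-line comparison `bgProvisoΛ_of_bgProviso` (the 11c token implies the ranged one — every theorem CONCLUDING `BgProviso` in the tree
transfers), its non-vacuity `bgProvisoΛ_one` ∕ the empty-window case `bgProvisoΛ_of_eq_zero`, and the CONSUMER face re-ranged — `HasSect2Form.norm_E_bg_le_Λ` (+ `…_of_admE`; the 3-line a.e. twin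
`HasSect2FormAE.norm_E_bg_le_Λ` is re-proved verbatim next to `HasSect2FormAE` by the record's pen, WORDS-123 (c)): the (2.27)(iv) bound `|𝐄^{(j)}(X, U_k(𝐖), z)| ≤ E₀ exp(−κ d_j(X))` at the background of record for every `X ⊂ Λ_j(s)` —
the only place the §2 form reads it (`Sect2.admE_eq_true_iff`).  A census of the tree (l.15537): `.bg` is consumed ONLY through `norm_E_bg_le` (Record11 :529,
Record12 :698, Record13 :634, each using the `spaceI` conjunct alone); the `spaceMS` conjunct has no consumer today.

HONEST FRAMING.  Definitions of record and bookkeeping faces; NOTHING of Bałaban's analysis is asserted (the ranged proviso is DISPLAYED by whoever keys it,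
exactly as 11c's was; print-true by [14], [15] and (2.7) on its ranges); no record is edited here (Record11∕12∕13 keep the 11c token; a successor record may
key `BgProvisoΛ` by name); K0′ (stmt-QuantumFields-19902) NOT discharged; counts unmoved; general `N`; finite `𝕋⁴_{L^K}` at fixed `ε = L^{−K}`; NOT a
continuum ∕ OS ∕ mass-gap ∕ Clay statement.
-/

open MeasureTheory Set

namespace Literature.MathematicalPhysics.QuantumFieldTheory.Balaban1983to89.Node00

open Literature.MathematicalPhysics.QuantumFieldTheory.Balaban1983to89
open T4Continuum B14.Eq218Concrete

noncomputable section

/-! ## §1  The proviso on print's ranges -/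

section Ranged

variable (F : T4Family) (N : ℕ) {𝔸 : Type*} [NormedRing 𝔸] [NormedAlgebra ℂ 𝔸] [CompleteSpace 𝔸]

/-- **THE BACKGROUND PROVISO OF p. 259 ON PRINT'S RANGES** (successor of 11c's `BgProviso`): on the support set `Supp s` of retained configurations, at every
scale `1 ≤ j ≤ k` and every localization domain `X ∈ 𝐃_j`, the background of record read in `Φ` lies (a) in `U^c_j(X, α_{0,j}, α_{1,j})` WHENEVER
`X ⊂ Λ_j(s)` — the (2.26)–(2.27) range of the 𝐄-terms («X ∈ 𝐃_j, z ∈ X ⊂ Λ_j»), which contains the (2.30) range `X ⊂ Λ_j^{∼−1}` of the 𝐑-terms — and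
(b) in `Ũ^c_j(X)` WHENEVER «X ∩ Ω_j ≠ ∅ and X ∩ Z̃_j ≠ ∅» — the (2.41)(i) range of the boundary terms (11b's `Sect2.admB`).  Print-true by [14], [15] and
(2.7) («the inductive assumptions (2.7) imply U_k ∈ U^c_j(X, α_{0,j}, α_{1,j}) for proper restrictions on ε_j»); DISPLAYED, never asserted.
[cite: Balaban1988Convergent, (2.26)–(2.28) p.259, (2.30) p.260, (2.41)(i) p.261] -/
def BgProvisoΛ (K : ℕ) (S : Sect2.Setting 𝔸 (SU N)) (Rz : Sect2.Residual (F.P K) 𝔸) {ν : Stage7Numerics} (M : ℕ) {g : ℕ → ℝ} {n : ℕ} (k : ℕ)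
    (Supp : SeqOfRecord F ν M g K n → Set (B15DeterminingSets.MSField (F.P K) (SU N))) (U : SeqOfRecord F ν M g K n → BgMap F N K) : Prop :=
  ∀ s W, W ∈ Supp s → ∀ j, 1 ≤ j → j ≤ k → ∀ X : (Sect2.domSys (F.P K) M j).Dom,
    (Sect2.domSites (F.P K) M j X ⊆ s.Λ j →
      Sect2.ofBackgroundC S.ι (U s W) ∈
        Sect2.spaceI S Rz M j (Sect2.domSites (F.P K) M j X) (S.lf.alpha0 (S.flow.g j)) (S.lf.alpha1 (S.flow.g j))) ∧
    (Sect2.admB (F.P K) ν M g s.Ω s.Λ j (Sect2.domSites (F.P K) M j X) = true →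
      Sect2.ofBackgroundC S.ι (U s W) ∈ Sect2.spaceMS S Rz M j (Sect2.domSites (F.P K) M j X) s.Ω)

variable {F N}

/-- **THE 11c TOKEN IMPLIES THE RANGED ONE** (restriction of the `X`-quantifier): every theorem of the tree concluding `BgProviso …` (K0b `Record12ResidualsBg`,
n11-e `Record12BgRowReduction`) transfers to `BgProvisoΛ` by this line. [cite: Balaban1988Convergent, (2.28) p.259 (bookkeeping)] -/
theorem bgProvisoΛ_of_bgProviso {K : ℕ} {S : Sect2.Setting 𝔸 (SU N)} {Rz : Sect2.Residual (F.P K) 𝔸} {ν : Stage7Numerics} {M : ℕ} {g : ℕ → ℝ} {n : ℕ}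
    {k : ℕ} {Supp : SeqOfRecord F ν M g K n → Set (B15DeterminingSets.MSField (F.P K) (SU N))} {U : SeqOfRecord F ν M g K n → BgMap F N K}
    (h : BgProviso F N K S Rz M k Supp U) : BgProvisoΛ F N K S Rz M k Supp U :=
  fun s W hW j h1 hj X => ⟨fun _ => (h s W hW j h1 hj X).1, fun _ => (h s W hW j h1 hj X).2⟩

/-- **NON-VACUITY**: the constant unit background map satisfies the ranged proviso (under the residual laws, the sign conditions and positive radii along the
flow) — from 11c's `bgProviso_one`. [cite: Balaban1988Convergent, (2.28) p.259; Balaban1987RG1, (1.15)–(1.16) p.262] -/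
theorem bgProvisoΛ_one [NeZero N] (K : ℕ) {S : Sect2.Setting 𝔸 (SU N)} (hS : S.Pos) {Rz : Sect2.Residual (F.P K) 𝔸} (hRz : Rz.Laws) {ν : Stage7Numerics} (M : ℕ)
    {g : ℕ → ℝ} {n : ℕ} (k : ℕ) (Supp : SeqOfRecord F ν M g K n → Set (B15DeterminingSets.MSField (F.P K) (SU N)))
    (hα₀ : ∀ m, 0 < S.lf.alpha0 (S.flow.g m)) (hα₁ : ∀ m, 0 < S.lf.alpha1 (S.flow.g m)) :
    BgProvisoΛ F N K S Rz M k Supp (fun _ _ => 1) :=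
  bgProvisoΛ_of_bgProviso (bgProviso_one K hS hRz M k Supp hα₀ hα₁)

/-- **THE EMPTY WINDOW**: at `k = 0` there is no scale `1 ≤ j ≤ k`, so the ranged proviso holds for every support set and background map (the level-0 row,
as n11-e's `bgProviso_zero` for the 11c token). [cite: Balaban1988Convergent, (2.28) p.259 (bookkeeping)] -/
theorem bgProvisoΛ_of_eq_zero {K : ℕ} (S : Sect2.Setting 𝔸 (SU N)) (Rz : Sect2.Residual (F.P K) 𝔸) {ν : Stage7Numerics} (M : ℕ) {g : ℕ → ℝ} {n : ℕ}
    {k : ℕ} (hk : k = 0) (Supp : SeqOfRecord F ν M g K n → Set (B15DeterminingSets.MSField (F.P K) (SU N)))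
    (U : SeqOfRecord F ν M g K n → BgMap F N K) : BgProvisoΛ F N K S Rz M k Supp U :=
  fun _ _ _ j h1 hj => absurd (h1.trans hj) (by omega)

/-- **MONOTONICITY IN THE SUPPORT SET**: a smaller support set inherits the proviso. [cite: Balaban1988Convergent, (2.28) p.259 (bookkeeping)] -/
theorem BgProvisoΛ.mono {K : ℕ} {S : Sect2.Setting 𝔸 (SU N)} {Rz : Sect2.Residual (F.P K) 𝔸} {ν : Stage7Numerics} {M : ℕ} {g : ℕ → ℝ} {n : ℕ} {k : ℕ}
    {Supp Supp' : SeqOfRecord F ν M g K n → Set (B15DeterminingSets.MSField (F.P K) (SU N))} {U : SeqOfRecord F ν M g K n → BgMap F N K}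
    (h : BgProvisoΛ F N K S Rz M k Supp U) (hle : ∀ s, Supp' s ⊆ Supp s) : BgProvisoΛ F N K S Rz M k Supp' U :=
  fun s W hW => h s W (hle s hW)

/-- **MONOTONICITY IN THE WINDOW**: the proviso up to scale `k` implies it up to any `k' ≤ k`. [cite: Balaban1988Convergent, (2.28) p.259 (bookkeeping)] -/
theorem BgProvisoΛ.of_le {K : ℕ} {S : Sect2.Setting 𝔸 (SU N)} {Rz : Sect2.Residual (F.P K) 𝔸} {ν : Stage7Numerics} {M : ℕ} {g : ℕ → ℝ} {n : ℕ} {k k' : ℕ}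
    {Supp : SeqOfRecord F ν M g K n → Set (B15DeterminingSets.MSField (F.P K) (SU N))} {U : SeqOfRecord F ν M g K n → BgMap F N K}
    (h : BgProvisoΛ F N K S Rz M k Supp U) (hk : k' ≤ k) : BgProvisoΛ F N K S Rz M k' Supp U :=
  fun s W hW j h1 hj => h s W hW j h1 (hj.trans hk)

/-- **THE `spaceI` CLAUSE ON THE (2.26)–(2.27) RANGE, READ OFF** (the form the consumers use). [cite: Balaban1988Convergent, (2.27)–(2.28) p.259 (bookkeeping)] -/
theorem BgProvisoΛ.mem_spaceI {K : ℕ} {S : Sect2.Setting 𝔸 (SU N)} {Rz : Sect2.Residual (F.P K) 𝔸} {ν : Stage7Numerics} {M : ℕ} {g : ℕ → ℝ} {n : ℕ} {k : ℕ}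
    {Supp : SeqOfRecord F ν M g K n → Set (B15DeterminingSets.MSField (F.P K) (SU N))} {U : SeqOfRecord F ν M g K n → BgMap F N K}
    (h : BgProvisoΛ F N K S Rz M k Supp U) (s : SeqOfRecord F ν M g K n) {W : B15DeterminingSets.MSField (F.P K) (SU N)} (hW : W ∈ Supp s)
    {j : ℕ} (h1 : 1 ≤ j) (hj : j ≤ k) (X : (Sect2.domSys (F.P K) M j).Dom) (hX : Sect2.domSites (F.P K) M j X ⊆ s.Λ j) :
    Sect2.ofBackgroundC S.ι (U s W) ∈
      Sect2.spaceI S Rz M j (Sect2.domSites (F.P K) M j X) (S.lf.alpha0 (S.flow.g j)) (S.lf.alpha1 (S.flow.g j)) :=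
  (h s W hW j h1 hj X).1 hX

/-- **THE `spaceMS` CLAUSE ON THE (2.41)(i) RANGE, READ OFF**. [cite: Balaban1988Convergent, (2.41)(i) p.261 (bookkeeping)] -/
theorem BgProvisoΛ.mem_spaceMS {K : ℕ} {S : Sect2.Setting 𝔸 (SU N)} {Rz : Sect2.Residual (F.P K) 𝔸} {ν : Stage7Numerics} {M : ℕ} {g : ℕ → ℝ} {n : ℕ} {k : ℕ}
    {Supp : SeqOfRecord F ν M g K n → Set (B15DeterminingSets.MSField (F.P K) (SU N))} {U : SeqOfRecord F ν M g K n → BgMap F N K}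
    (h : BgProvisoΛ F N K S Rz M k Supp U) (s : SeqOfRecord F ν M g K n) {W : B15DeterminingSets.MSField (F.P K) (SU N)} (hW : W ∈ Supp s)
    {j : ℕ} (h1 : 1 ≤ j) (hj : j ≤ k) (X : (Sect2.domSys (F.P K) M j).Dom)
    (hX : (Sect2.domSites (F.P K) M j X ∩ s.Ω j).Nonempty ∧ (Sect2.domSites (F.P K) M j X ∩ Sect2.enlT (F.P K) (Sect2.zSide (F.P K) ν M g j) 1 (s.Λ j)ᶜ).Nonempty) :
    Sect2.ofBackgroundC S.ι (U s W) ∈ Sect2.spaceMS S Rz M j (Sect2.domSites (F.P K) M j X) s.Ω :=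
  (h s W hW j h1 hj X).2 ((Sect2.admB_eq_true_iff ν M g s.Ω s.Λ j _).mpr hX)

/-- **WHERE THE 𝐄-TERMS ARE SUMMED, THE RANGE CLAUSE HOLDS**: `admE … j X z = true` forces `X ⊂ Λ_j` (11b's `Sect2.admE_eq_true_iff`, third clause) — so the
ranged proviso covers every 𝐄-term the §2 form reads. [cite: Balaban1988Convergent, (2.26)–(2.27) p.259 (bookkeeping)] -/
theorem subset_Λ_of_admE {K : ℕ} (ν : Stage7Numerics) (M : ℕ) (g : ℕ → ℝ) (Λ : ℕ → Set (Site (F.P K) 0)) (j : ℕ) (Y : Set (Site (F.P K) 0))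
    (z : Site (F.P K) j) (h : Sect2.admE (F.P K) ν M g Λ j Y z = true) : Y ⊆ Λ j :=
  ((Sect2.admE_eq_true_iff ν M g Λ j Y z).mp h).2.2

end Ranged

/-! ## §2  The consumer faces on the range: (2.27)(iv) at the background of record -/

section Consumers

open Tk

variable {F : T4Family} {N : ℕ} [NeZero N] {V : Type} [NormedAddCommGroup V] [InnerProductSpace ℝ V] [FiniteDimensional ℝ V]
  [MeasurableSpace V] [BorelSpace V] {𝔸 : Type*} [NormedRing 𝔸] [NormedAlgebra ℂ 𝔸] [CompleteSpace 𝔸]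

/-- **THE BOUND (2.27)(iv) BITES AT THE BACKGROUND OF RECORD, ON PRINT'S RANGE** (ranged twin of 11c's `HasSect2Form.norm_E_bg_le`): under the §2 form at index
`k` and the ranged proviso, for every sequence `s`, retained `𝐖 ∈ Supp s`, scale `1 ≤ j ≤ k`, domain `X ⊂ Λ_j(s)`, point `z` and coupling `g ∈ [0, γ]`, the
witnessing 𝐄-terms obey `|𝐄^{(j)}(X, U_k(𝐖), z)| ≤ E₀ exp(−κ d_j(X))`. [cite: Balaban1988Convergent, (2.23) p.258, (2.27)(iv)–(2.28) p.259] -/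
theorem HasSect2Form.norm_E_bg_le_Λ {K : ℕ} {S : Sect2.Setting 𝔸 (SU N)} {Rz : Sect2.Residual (F.P K) 𝔸} {W : TkWeights F N V K} {ν : Stage7Numerics}
    {M : ℕ} {g : ℕ → ℝ} {k : ℕ} {U : SeqOfRecord F ν M g K k → BgMap F N K} {slot : SeqOfRecord F ν M g K k → Density (F.P K) k (SU N)}
    (h : HasSect2Form F N V K S Rz W k U slot) {Supp : SeqOfRecord F ν M g K k → Set (B15DeterminingSets.MSField (F.P K) (SU N))}
    (hU : BgProvisoΛ F N K S Rz M k Supp U) :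
    ∃ t : SeqOfRecord F ν M g K k → Sect2.TermValues (F.P K) 𝔸 V M, Sect2.UniversalE t ∧
      ∀ s Wc, Wc ∈ Supp s → ∀ j, 1 ≤ j → j ≤ k → ∀ (X : (Sect2.domSys (F.P K) M j).Dom), Sect2.domSites (F.P K) M j X ⊆ s.Λ j →
        ∀ (z : Site (F.P K) j) (g' : ℝ), 0 ≤ g' → g' ≤ S.lf.γ →
          ‖(t s).E j X z g' (Sect2.ofBackgroundC S.ι (U s Wc))‖ ≤ S.lf.E₀ * Real.exp (-S.lf.κ * (Sect2.domSys (F.P K) M j).dj X) := by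
  obtain ⟨t, Ek, hu, hs⟩ := h
  refine ⟨t, hu, fun s Wc hW j h1 hj X hX z g' hg0 hgγ => ?_⟩
  exact (hs s).1.1.boundE j h1 hj X z g' _ hg0 hgγ ((hU s Wc hW j h1 hj X).1 hX)

/-- **AT THE POINTS WHERE THE FORM READS AN 𝐄-TERM** (`admE … = true`), the bound holds with no separate range hypothesis.
[cite: Balaban1988Convergent, (2.26)–(2.27) p.259 (bookkeeping)] -/
theorem HasSect2Form.norm_E_bg_le_of_admE {K : ℕ} {S : Sect2.Setting 𝔸 (SU N)} {Rz : Sect2.Residual (F.P K) 𝔸} {W : TkWeights F N V K}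
    {ν : Stage7Numerics} {M : ℕ} {g : ℕ → ℝ} {k : ℕ} {U : SeqOfRecord F ν M g K k → BgMap F N K}
    {slot : SeqOfRecord F ν M g K k → Density (F.P K) k (SU N)} (h : HasSect2Form F N V K S Rz W k U slot)
    {Supp : SeqOfRecord F ν M g K k → Set (B15DeterminingSets.MSField (F.P K) (SU N))} (hU : BgProvisoΛ F N K S Rz M k Supp U) :
    ∃ t : SeqOfRecord F ν M g K k → Sect2.TermValues (F.P K) 𝔸 V M, Sect2.UniversalE t ∧
      ∀ s Wc, Wc ∈ Supp s → ∀ j, 1 ≤ j → j ≤ k → ∀ (X : (Sect2.domSys (F.P K) M j).Dom) (z : Site (F.P K) j),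
        Sect2.admE (F.P K) ν M g s.Λ j (Sect2.domSites (F.P K) M j X) z = true → ∀ g' : ℝ, 0 ≤ g' → g' ≤ S.lf.γ →
          ‖(t s).E j X z g' (Sect2.ofBackgroundC S.ι (U s Wc))‖ ≤ S.lf.E₀ * Real.exp (-S.lf.κ * (Sect2.domSys (F.P K) M j).dj X) := by
  obtain ⟨t, hu, ht⟩ := h.norm_E_bg_le_Λ hU
  exact ⟨t, hu, fun s Wc hW j h1 hj X z hz g' hg0 hgγ => ht s Wc hW j h1 hj X (subset_Λ_of_admE ν M g s.Λ j _ z hz) z g' hg0 hgγ⟩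

end Consumers

end

end Literature.MathematicalPhysics.QuantumFieldTheory.Balaban1983to89.Node00
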